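import Summits.Ventures.HSemireg.Pad4FirstOrderModel
import Summits.Ventures.HSemireg.Pad4PhaseKernelCertificate

/-!
# Venture HSemireg — DEMAND SEAM between the PAD-4 first-order MODEL (FILE A, row 716) and the PHASE-KERNEL CERTIFICATE
# (FILE B1, row 717): FILE A's first-order class `ob_κ(X)` on a pair piece IS (minus) FILE B1's `imPiece`, so B1's kernel-
# certified phase steps — the (L1) LEAK demand and the (P3) Q̃ escape, for ALL charges — hold in FILE A's own vocabulary

HONEST FRAMING. PROVED bookkeeping (gs-eng-2 g48, 2026-08-27; companion of typer g7's effectivity seam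
`Pad4FirstOrderModelPhaseKernelSeam`, which covers (P0)). `Pad4FirstOrderModel.lean` (p505821) and
`Pad4PhaseKernelCertificate.lean` (p510800) were filed STANDALONE; the only link was a sentence in each header and the referees'
by-eye check that the `κ ∈ T_W ≅ M₄` models agree (FIRSTORDER §1 ∕ THEOREM-L (6.6)(iii): `κ(e_{A_g}) = Σ_j k_{jg} ē_{B_j}`,
`κ(e_{B_j}) = Σ_g k_{jg} ē_{A_g}`; `ξ_ζ = e_A + ζ e_B`, `ξ̄_ζ = ē_A + ζ̄ ē_B`). This file makes the link a KERNEL statement. For an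
INTEGER direction `k` (read as the complex matrix `kOf k`) and ANY constituent `X` of the model:
* `ob_pair01` ∕ `ob_pair12` — FILE A's `ob X κ` on the degree pattern `qPair 0 1` (resp. `qPair 1 2`) at the `V ⊗ V` indices
  equals MINUS the complex image of B1's `imPiece 0 1` (resp. `imPiece 1 2`) built from `X`'s own charges and phases on those two
  factors (letters on the other factors reach neither side; the sign is the wedge-order convention `ξ̄ ∧ κ(ξ)` vs `κ(ξ) ∧ ξ̄`,
  noted by the referees as immaterial);
* `demandW01_eq`, `demandW01_ne_zero` — contracting the (0,1)-demand with FILE A's own quotient functional `w_{ζ_1}` (`wCoef`,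
  kernel `Ξ_{ζ_1}`; PAD4-LEAK §1 «V·R_e → R_e ⊗ W by w_ζ») gives the complex image of B1's F-test `contractF`; hence, by B1's
  `leak_demand_all_charges` and the injectivity of `GaussianInt.toComplex`: **for every constituent charged on factor 0 (any
  charges, any phases) the single direction `κ₀ = E_{10}` yields a (0,1)-demand that is non-zero in `V_0 ⊗ W_1`** — the (L1) ∕
  (P2) step of THEOREM L^ζ at a top flag, in the model's terms;
* `ob12_in_plane`, `ob12_escape` — for a constituent charged on factor 1 and uncharged on factor 2 (`Q̃`-shape on the pair
  (1,2)) the (1,2)-demand rows satisfy «`ē_B`-row = ζ̄_1 · `ē_A`-row» (the piece lies in `ξ̄_{ζ_1} ⊗ V_2`, B1 `qtilde_in_plane_all`)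
  and the directions `E_{21}`, `E_{12}` give rows with non-zero determinant (B1 `qtilde_escape_all_charges`) — the (P3) escape.
Factor labels are fixed (`0, 1` resp. `1, 2`) as in FILE B1; the model is `S₄`-symmetric in the labels. WHAT IS NOT HERE: any
statement about the (E1) systems, sections, pins, the change of splitting, `TheoremLZeta` (kernel-OPEN), or HC ∕ HC_CM ∕ HC_AV —
NOTHING HERE SAYS ANY OF THOSE IS PROVED; no fact, no instance, no notation, 0 `sorry`. Typed ≠ proved ≠ endorsed.
-/

namespace Summit.Ventures.HSemireg.Pad4PhaseKernelDemandSeam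

open Summit.Ventures.HSemireg Pad4PhaseKernel Pad4FirstOrder GaussianInt

/-- an integer Weil direction `k ∈ T_W(ℤ[i])` read as a complex matrix (FILE A's `κ`). -/
noncomputable def kOf (k : TW) : Matrix (Fin 4) (Fin 4) ℂ := fun j g => ((k j g : GaussianInt) : ℂ)

/-- the coordinate of a `Vec4` (B1) at FILE A's index pair `(o_s, o_f)`, `(0,0) ↦ ē_A`, `(1,0) ↦ ē_B`; other indices `0`. -/
noncomputable def coordC (w : Vec4) (p q : ℕ × ℕ) : ℂ :=
  if p = (0,0) ∧ q = (0,0) then (w.aa : ℂ) else if p = (0,0) ∧ q = (1,0) then (w.ab : ℂ)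
  else if p = (1,0) ∧ q = (0,0) then (w.ba : ℂ) else if p = (1,0) ∧ q = (1,0) then (w.bb : ℂ) else 0

/-- B1's phase `i^k ∈ ℤ[i]` read in `ℂ` is FILE A's `zetaC k`. [kernel] -/
theorem toC_phase (k : Fin 4) : ((phase k : GaussianInt) : ℂ) = zetaC k := by
  fin_cases k <;> simp [phase, zetaC, toComplex_def₂, Complex.ext_iff, pow_succ, Complex.I_mul_I]

/-- B1's conjugate phase read in `ℂ` is FILE A's `zetaBar k`. [kernel] -/
theorem toC_star_phase (k : Fin 4) : ((star (phase k) : GaussianInt) : ℂ) = zetaBar k := by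
  fin_cases k <;> simp [phase, zetaBar, zetaC, toComplex_def₂, Complex.ext_iff, pow_succ, Complex.inv_I]


/-- `conj (i^k) = (i^k)⁻¹` = FILE A's `zetaBar`. [kernel] -/
theorem conj_zetaC (k : Fin 4) : (starRingEnd ℂ) (zetaC k) = zetaBar k := by
  fin_cases k <;> simp [zetaBar, zetaC, pow_succ, Complex.inv_I, Complex.conj_I]

/-- the degree pattern of the pair (0,1) is not a `Λ²V_f` pattern. [kernel, `decide`] -/
theorem qPair01_ne_single (f : Fin 4) : qPair 0 1 ≠ Pi.single f 2 := by fin_cases f <;> decide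
/-- `qPair f τ` is the (0,1) pattern iff `{f, τ} = {0, 1}`. [kernel, `decide`] -/
theorem qPair01_eq_iff (f τ : Fin 4) : qPair 0 1 = qPair f τ ↔ (f = 0 ∧ τ = 1) ∨ (f = 1 ∧ τ = 0) := by
  fin_cases f <;> fin_cases τ <;> decide

/-- **BRIDGE (0,1)**: FILE A's demand `ob X κ` on the pair piece `V_0 ⊗ V_1`, for an integer direction `κ = k`, is MINUS the
B1 pair piece `imPiece 0 1` of the same constituent (letters on factors 0 and 1; third-factor letters reach neither side). -/
theorem ob_pair01 (X : Constituent) (k : TW) (o : Fin 4 → ℕ × ℕ)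
    (h0 : o 0 = (0,0) ∨ o 0 = (1,0)) (h1 : o 1 = (0,0) ∨ o 1 = (1,0)) :
    ob X (kOf k) (qPair 0 1) o =
      - coordC (imPiece 0 1 (X.charge 0) (phase (X.phase 0)) (X.charge 1) (phase (X.phase 1)) k) (o 0) (o 1) := by
  unfold ob
  simp only [Fin.sum_univ_four, qPair01_ne_single, if_false, qPair01_eq_iff]
  simp
  rcases h0 with h0 | h0 <;> rcases h1 with h1 | h1 <;>
    simp [h0, h1, xiBar, kap, kOf, coordC, imPiece, Vec4.add, Vec4.smul, wedgePiece, kappaXi, kappaA, kappaB, xibar,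
      toC_phase, conj_zetaC, map_mul, map_add, map_neg, map_natCast] <;>
    ring


/-- the degree pattern of the pair (1,2) is not a `Λ²V_f` pattern. [kernel, `decide`] -/
theorem qPair12_ne_single (f : Fin 4) : qPair 1 2 ≠ Pi.single f 2 := by fin_cases f <;> decide
/-- `qPair f τ` is the (1,2) pattern iff `{f, τ} = {1, 2}`. [kernel, `decide`] -/
theorem qPair12_eq_iff (f τ : Fin 4) : qPair 1 2 = qPair f τ ↔ (f = 1 ∧ τ = 2) ∨ (f = 2 ∧ τ = 1) := by
  fin_cases f <;> fin_cases τ <;> decide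

/-- **BRIDGE (1,2)**: the same for the pair piece `V_1 ⊗ V_2` (used for Q̃'s `(f,τ)`-piece, `f = 1`, `τ = 2`). -/
theorem ob_pair12 (X : Constituent) (k : TW) (o : Fin 4 → ℕ × ℕ)
    (h1 : o 1 = (0,0) ∨ o 1 = (1,0)) (h2 : o 2 = (0,0) ∨ o 2 = (1,0)) :
    ob X (kOf k) (qPair 1 2) o =
      - coordC (imPiece 1 2 (X.charge 1) (phase (X.phase 1)) (X.charge 2) (phase (X.phase 2)) k) (o 1) (o 2) := by
  unfold ob
  simp only [Fin.sum_univ_four, qPair12_ne_single, if_false, qPair12_eq_iff]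
  simp
  rcases h1 with h1 | h1 <;> rcases h2 with h2 | h2 <;>
    simp [h1, h2, xiBar, kap, kOf, coordC, imPiece, Vec4.add, Vec4.smul, wedgePiece, kappaXi, kappaA, kappaB, xibar,
      toC_phase, conj_zetaC, map_mul, map_add, map_neg, map_natCast] <;>
    ring


/-! ## §3 B1's phase lemmas in FILE A's vocabulary -/

/-- index function with prescribed values on factors 0 and 1 (others `(0,0)`). -/
def o01 (p q : ℕ × ℕ) : Fin 4 → ℕ × ℕ := fun g => if g = 0 then p else if g = 1 then q else (0, 0)
/-- index function with prescribed values on factors 1 and 2 (others `(0,0)`). -/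
def o12 (p q : ℕ × ℕ) : Fin 4 → ℕ × ℕ := fun g => if g = 1 then p else if g = 2 then q else (0, 0)

/-- the (0,1)-demand contracted by FILE A's `w_{ζ_1}` on factor 1 (the `V_0 ⊗ W_1`-quotient of PAD4-LEAK §1): at index `p` of `V_0`. -/
noncomputable def demandW01 (X : Constituent) (κ : Matrix (Fin 4) (Fin 4) ℂ) (p : ℕ × ℕ) : ℂ :=
  wCoef (X.phase 1) (0, 0) * ob X κ (qPair 0 1) (o01 p (0, 0)) + wCoef (X.phase 1) (1, 0) * ob X κ (qPair 0 1) (o01 p (1, 0))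

/-- the contracted demand is the complex image of B1's F-test `contractF` (componentwise). -/
theorem demandW01_eq (X : Constituent) (k : TW) :
    demandW01 X (kOf k) (0, 0) = ((contractF (phase (X.phase 1))
        (imPiece 0 1 (X.charge 0) (phase (X.phase 0)) (X.charge 1) (phase (X.phase 1)) k)).1 : ℂ) ∧
    demandW01 X (kOf k) (1, 0) = ((contractF (phase (X.phase 1))
        (imPiece 0 1 (X.charge 0) (phase (X.phase 0)) (X.charge 1) (phase (X.phase 1)) k)).2 : ℂ) := by
  constructor <;>
  · simp only [demandW01]
    rw [ob_pair01 X k _ (by simp [o01]) (by simp [o01]), ob_pair01 X k _ (by simp [o01]) (by simp [o01])]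
    simp [o01, coordC, contractF, wCoef, toC_phase, conj_zetaC, map_mul, map_sub, toComplex_star]
    ring

/-- **(L1) IN FILE A's VOCABULARY.** For every constituent charged on factor 0 (any charges, any phases) the direction
`κ₀ = E_{10}` (`k_{1 0} = 1`) gives a (0,1)-demand `ob X κ₀` that is NON-ZERO in `V_0 ⊗ W_1` — B1's `leak_demand_all_charges`
transported through the bridge and `GaussianInt.toComplex` injectivity. -/
theorem demandW01_ne_zero (X : Constituent) (h : X.charge 0 ≠ 0) :
    demandW01 X (kOf (stdDir 1 0)) (0, 0) ≠ 0 ∨ demandW01 X (kOf (stdDir 1 0)) (1, 0) ≠ 0 := by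
  have key := leak_demand_all_charges (X.phase 0) (X.phase 1) (X.charge 0) (X.charge 1) h
  obtain ⟨e1, e2⟩ := demandW01_eq X (stdDir 1 0)
  by_contra hc
  push Not at hc
  obtain ⟨h1, h2⟩ := hc
  apply key
  rw [h1] at e1; rw [h2] at e2
  have z1 := (toComplex_eq_zero.mp e1.symm)
  have z2 := (toComplex_eq_zero.mp e2.symm)
  exact Prod.ext z1 z2


/-- with no charge on factor `f` the second letter's phase is immaterial in `imPiece`. -/
theorem imPiece_zero_right (s f : Fin 4) (cs ζs ζ ζ' : GaussianInt) (k : TW) :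
    imPiece s f cs ζs 0 ζ k = imPiece s f cs ζs 0 ζ' k := by
  simp [imPiece, Vec4.smul, Vec4.add]

/-- **(P3) IN FILE A's VOCABULARY — containment.** For a constituent charged on factor 1 and UNCHARGED on factor 2 (`Q̃`-shape
on the pair (1,2)), every (1,2)-demand row at the `ē_{B_1}` index is `ζ̄_1` times the row at the `ē_{A_1}` index: the piece lies in
`ξ̄_{ζ_1} ⊗ V_2` (B1 `qtilde_in_plane_all`, any integer direction `k`). -/
theorem ob12_in_plane (X : Constituent) (h2 : X.charge 2 = 0) (k : TW) (q : ℕ × ℕ) (hq : q = (0,0) ∨ q = (1,0)) :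
    ob X (kOf k) (qPair 1 2) (o12 (1, 0) q) = zetaBar (X.phase 1) * ob X (kOf k) (qPair 1 2) (o12 (0, 0) q) := by
  have key := qtilde_in_plane_all k (X.charge 1 : GaussianInt) (phase (X.phase 1))
  rw [ob_pair12 X k _ (by simp [o12]) (by rcases hq with hq | hq <;> simp [o12, hq]),
      ob_pair12 X k _ (by simp [o12]) (by rcases hq with hq | hq <;> simp [o12, hq])]
  simp only [o12, h2, Nat.cast_zero]
  rw [imPiece_zero_right 1 2 _ _ (phase (X.phase 2)) 0 k, ← key]
  rcases hq with hq | hq <;>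
    simp [hq, coordC, tens, xib, qtildeU, toC_phase, conj_zetaC, map_mul, toComplex_star]

/-- **(P3) IN FILE A's VOCABULARY — escape.** For a constituent charged (`c_1 ≥ 1`) on factor 1 and uncharged on factor 2 the
two directions `E_{21}`, `E_{12}` give (1,2)-demand rows (at the `ē_{A_1}` index) with NON-ZERO determinant — together with
`ob12_in_plane` the (1,2)-demands span exactly `ξ̄_{ζ_1} ⊗ V_2` (dimension 2), outside every σ-plane (B1 `qtilde_escape_all_charges`). -/
theorem ob12_escape (X : Constituent) (h1 : X.charge 1 ≠ 0) (h2 : X.charge 2 = 0) :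
    ob X (kOf (stdDir 2 1)) (qPair 1 2) (o12 (0,0) (0,0)) * ob X (kOf (stdDir 1 2)) (qPair 1 2) (o12 (0,0) (1,0))
      - ob X (kOf (stdDir 2 1)) (qPair 1 2) (o12 (0,0) (1,0)) * ob X (kOf (stdDir 1 2)) (qPair 1 2) (o12 (0,0) (0,0)) ≠ 0 := by
  have key := qtilde_escape_all_charges (X.phase 1) (X.charge 1) h1
  rw [ob_pair12 X _ _ (by simp [o12]) (by simp [o12]), ob_pair12 X _ _ (by simp [o12]) (by simp [o12]),
      ob_pair12 X _ _ (by simp [o12]) (by simp [o12]), ob_pair12 X _ _ (by simp [o12]) (by simp [o12])]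
  simp only [o12, h2, Nat.cast_zero]
  rw [imPiece_zero_right 1 2 _ _ (phase (X.phase 2)) 0 (stdDir 2 1), imPiece_zero_right 1 2 _ _ (phase (X.phase 2)) 0 (stdDir 1 2)]
  intro hzero
  apply key
  apply toComplex_eq_zero.mp
  simp only [qtildeU, map_sub, map_mul]
  simp [coordC] at hzero
  linear_combination hzero

end Summit.Ventures.HSemireg.Pad4PhaseKernelDemandSeam

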